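/-
Copyright (c) 2026 the pub-hodgecm-mathlib formalisation cell (harness21).  Prover seat hodgecm-mathlib-LH4-p11 (g0) = MS FIRST SEAT of the (S)-heads re-line «NI2 ⊕ MS»
(heir LEAD F0P3a-plan (g19) RULING (R-17) T18-15; dealer LH4-plan (g10) WORD #42 (1)); the DEFS LEAF of MS ROAD A step (3) (`F0/P3c/LH4/LH4-p11/g0/MS-ROAD-A-BRICKS.v2`).  2026-09-03.
-/
import Literature.NumberTheory.Automorphic.UnitaryLatticeTreeFrameChange   -- ★ `mapGL_mul`, `mapGL_one`, `mapGL_inv_mapGL`; brings ★ `UnitaryLatticeTreeDefs` (`mapGL`, `latt`, `IsVertexLattice`)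
import Mathlib.GroupTheory.Index                                           -- `Subgroup.relIndex`
import HarnessLib

/-!
# Crux `H413`, line LH4 «(D-RAM) FOUR-FRAME» road — unit U3_Laws (iii), MS ROAD A: DEFS LEAF «THE DIAGONAL TORUS» (the named objects of step (3) = (3c-iii) «orbit count»)

Cell `hodgecm-mathlib` (D-0151), FLOOR 0, crux item H413 = `stmt-HodgeConjecture-24833`, route of record `HCCMUnconditional`; squad F0∕P3c∕LH4 (req618∕req620); registered stub served:
`F0P3cDyRamFourFrameU3.stub_U3_stableModelSum` (MS; tree `Cruxes/H413/Lines/F0_P3c_DyRamFourFrame_U3_Laws.lean` ED. 4 :102).  DEFINITIONS ONLY (+ `Iff.rfl` ∕ `rfl`-grade ties);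
no instance, no notation, no `sorry`, no theorem asserting anything about `U(3)`; lane `--supports stmt-HodgeConjecture-24833 --as helper` (count-neutral).  Precedents: ★ DEFS leaves
`F0P3cDyRamFourFrameLawDefs`, `…CensusDefs`, `…Pieces`.

WHY A DEFS LEAF.  The MS assembly (O) «Σ_{s} #{M : M type-0 for diag(d_s), T·M = M} = 8 · Σ_{M₀ ∈ 𝓛₀ dualisable} 1∕[𝒰 : S_F(M₀)]» (LH4-p10 MEMO-stableLaw-finite v1 §2 (3)) and its
sub-bricks (O1) «orbit of a normalised lattice ≃ 𝒯∕S̃», (O2) «pair count» must QUOTE the unit torus `𝒯 = (𝒪^×)^N ≤ (K^×)^N`, its `σ`-fixed part `𝒰`, the norm map `z ↦ z·σz` (kernel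
`T_u = (E¹)^N`), the diagonal stabilisers `S̃(M) = Stab_𝒯(M) ⊇ S_F(M) = Stab_𝒰(M)`, «normalised», «dualisable» and the weight `1∕[𝒰 : S_F(M)]` BY NAME; Theorems files declare no `def`
(T11-93 ∕ T17-28 (D2′)).  The ★ lemma layer these names package is already in the tree: ★ p855400 (TARGET I, duality under `diag z`), ★ p855415 (K, vertex transport under `diag z`),
★ p855425∕p855450 (J∕J′, normalisation section and the `𝒯`-orbit of a normalised lattice), ★ p855451 (L, congruence units stabilise), ★ p855457 (M, `𝒰∕N𝒯 ≅ (ℤ∕2)^N` under NI2),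
★ p855435 (N, the abelian index identity), ★ p855307 ((3b) self-duality fibre = stabiliser coset), ★ p855383 ((3c-ii) the stabiliser ORDER `Λ_S`), ★ p855032 §1 (form transport).

CONTENTS (generic `N`; `K` any field with `Valued K ℤᵐ⁰`).  §1 `diagGLUnits : (Fin N → Kˣ) →* GL_N(K)` (`z ↦ diag z`).  §2 `unitTorus` (`|z_i| = 1`), `fixedTorus σ` (`σ z_i = z_i`),
`fixedUnitTorus σ = unitTorus ⊓ fixedTorus σ` (= `𝒰`), `unitNormMap σ : z ↦ (z_i·σ z_i)_i` (a group endomorphism of the commutative group `(K^×)^N`; `T_u := ker`).  §3 `latticeStabilizer M`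
(`diag z · M = M`; = `S̃(M)` after `⊓ unitTorus`, `S_F(M)` after `⊓ fixedUnitTorus σ`), `stabiliserWeight σ M : ℚ := ([𝒰 : S_F(M)])⁻¹` via `Subgroup.relIndex` (finite by ★ L + `Fintype 𝓀`).
§4 `IsNormalisedLattice M` (every coordinate ideal is exactly `𝒪`; ★ p855280∕p855425 spelling), `IsDualisableLattice σ ϖ M` (self-dual for SOME `σ`-fixed non-degenerate diagonal form;
★ p855415 makes it `𝒯·ϖ^{ℤ}`-invariant), `normalisedStableLattices T` (the set `𝓛₀(T)`; finite by ★ p12's brick).  §5 `Iff.rfl` ties.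
HONEST LABEL.  Count-neutral vehicle; defines, asserts nothing; (MS) stays a PROVER TARGET (empirical census law); `HC_CM` is proved only modulo the 7 printed citations (2 remaining named
inputs: hLiu418 = `stmt-HodgeConjecture-24832`, h413 = `stmt-HodgeConjecture-24833`) until rung 0 closes.

## References
* [Kottwitz1986BaseChangeUnits] R. E. Kottwitz, *Base change for unit elements of Hecke algebras*, Compositio Math. 60 (1986), §1 pp. 240–241 (orbital integrals of units as lattice counts; the torus quotient).
* [Rogawski1990] J. D. Rogawski, *Automorphic Representations of Unitary Groups in Three Variables*, Ann. of Math. Stud. 123 (1990), §4.9 Prop. 4.9.1 (a) p. 55.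
* [Serre1980Trees] J.-P. Serre, *Trees*, Springer (1980), Ch. II §1.1 (lattices, diagonal action).
-/

set_option autoImplicit false

noncomputable section

namespace Summit.HodgeConjecture.HodgeConjecture.Cruxes.H413.F0P3cDyRamDiagonalTorusDefs

open Matrix
open Literature.NumberTheory.Automorphic Literature.NumberTheory.Automorphic.HermitianLattice
open Literature.NumberTheory.Automorphic.UnitaryLatticeTree
open scoped Valued WithZero Matrix MatrixGroups

variable {K : Type*} [Field K] [Valued K ℤᵐ⁰] {N : ℕ}

/-! ## §1  The diagonal embedding `(K^×)^N →* GL_N(K)` -/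

/-- `diag z ∈ GL_N(K)` for a vector of units `z : Fin N → Kˣ`, as a group homomorphism (inverse = `diag z⁻¹`). [cite: Serre1980Trees, II §1.1] -/
def diagGLUnits : (Fin N → Kˣ) →* GL (Fin N) K where
  toFun z :=
    ⟨Matrix.diagonal fun i => (z i : K), Matrix.diagonal fun i => ((z i)⁻¹ : Kˣ),
      by rw [Matrix.diagonal_mul_diagonal, ← Matrix.diagonal_one]; congr 1; funext i; rw [Units.mul_inv],
      by rw [Matrix.diagonal_mul_diagonal, ← Matrix.diagonal_one]; congr 1; funext i; rw [Units.inv_mul]⟩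
  map_one' := Units.ext (by simp)
  map_mul' z w := Units.ext (by
    change Matrix.diagonal (fun i => ((z * w) i : K)) = Matrix.diagonal (fun i => (z i : K)) * Matrix.diagonal (fun i => (w i : K))
    rw [Matrix.diagonal_mul_diagonal]; rfl)

omit [Valued K ℤᵐ⁰] in
/-- The matrix of `diagGLUnits z` is `diag (z_i)`. [cite: Serre1980Trees, II §1.1] -/
theorem coe_diagGLUnits (z : Fin N → Kˣ) : ((diagGLUnits z : GL (Fin N) K) : Matrix (Fin N) (Fin N) K) = Matrix.diagonal fun i => (z i : K) := rfl

/-! ## §2  The unit torus `𝒯`, its `σ`-fixed part `𝒰`, the norm map and its kernel `T_u` -/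

/-- **THE UNIT TORUS `𝒯 = (𝒪^×)^N ≤ (K^×)^N`**: vectors of units of valuation `1`. [cite: Kottwitz1986BaseChangeUnits, §1 pp. 240–241] -/
def unitTorus (K : Type*) [Field K] [Valued K ℤᵐ⁰] (N : ℕ) : Subgroup (Fin N → Kˣ) where
  carrier := {z | ∀ i, Valued.v (z i : K) = 1}
  one_mem' i := by simp
  mul_mem' {z w} hz hw i := by rw [Pi.mul_apply, Units.val_mul, map_mul, hz i, hw i, mul_one]
  inv_mem' {z} hz i := by rw [Pi.inv_apply, Units.val_inv_eq_inv_val, map_inv₀, hz i, inv_one]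

/-- **THE `σ`-FIXED VECTORS** `{z | σ z_i = z_i}` (for the datum's involution `σ`: the `F`-rational diagonal elements, `F = K^σ`). [cite: Rogawski1990, §4.9 p. 55] -/
def fixedTorus (σ : K →+* K) (N : ℕ) : Subgroup (Fin N → Kˣ) where
  carrier := {z | ∀ i, σ (z i : K) = z i}
  one_mem' i := by simp
  mul_mem' {z w} hz hw i := by rw [Pi.mul_apply, Units.val_mul, map_mul, hz i, hw i]
  inv_mem' {z} hz i := by rw [Pi.inv_apply, Units.val_inv_eq_inv_val, map_inv₀, hz i]

/-- **`𝒰 = (𝒪_F^×)^N`**: the `σ`-fixed unit vectors, `unitTorus ⊓ fixedTorus σ`. [cite: Rogawski1990, §4.9 p. 55] -/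
def fixedUnitTorus (σ : K →+* K) (N : ℕ) : Subgroup (Fin N → Kˣ) := unitTorus K N ⊓ fixedTorus σ N

/-- **THE NORM MAP `z ↦ (z_i · σ z_i)_i`** on `(K^×)^N` (a group endomorphism; its kernel is the norm-one torus `T_u = (E¹)^N`, its image on `𝒯` has index `2^N` in `𝒰` under NI2 —
★ p855457). [cite: Rogawski1990, §4.9 p. 55] -/
def unitNormMap (σ : K →+* K) (N : ℕ) : (Fin N → Kˣ) →* (Fin N → Kˣ) where
  toFun z i := z i * Units.map (σ : K →* K) (z i)
  map_one' := by funext i; simp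
  map_mul' z w := by funext i; simp only [Pi.mul_apply, map_mul]; exact mul_mul_mul_comm _ _ _ _

/-- **THE NORM-ONE TORUS `T_u`** = the kernel of the norm map (`z_i σ z_i = 1` for all `i`). [cite: Rogawski1990, §4.9 p. 55] -/
def normOneTorus (σ : K →+* K) (N : ℕ) : Subgroup (Fin N → Kˣ) := (unitNormMap σ N).ker

/-! ## §3  Diagonal stabilisers and the weight -/

/-- **THE DIAGONAL STABILISER of an `𝒪`-submodule `M ≤ K^N`**: `{z ∈ (K^×)^N | diag z · M = M}` (a subgroup; `S̃(M)` = its intersection with `unitTorus`, `S_F(M)` with `fixedUnitTorus σ`;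
by ★ p855383 its unit integral points are the units of the ORDER `Λ_S(M)`). [cite: Kottwitz1986BaseChangeUnits, §1 pp. 240–241] -/
def latticeStabilizer (M : Submodule 𝒪[K] (Fin N → K)) : Subgroup (Fin N → Kˣ) where
  carrier := {z | mapGL (diagGLUnits z) M = M}
  one_mem' := by
    change mapGL (diagGLUnits (1 : Fin N → Kˣ)) M = M
    rw [map_one, mapGL_one]
  mul_mem' {z w} hz hw := by
    change mapGL (diagGLUnits (z * w)) M = M
    change mapGL (diagGLUnits z) M = M at hz
    change mapGL (diagGLUnits w) M = M at hw
    rw [map_mul, mapGL_mul, hw, hz]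
  inv_mem' {z} hz := by
    change mapGL (diagGLUnits z⁻¹) M = M
    change mapGL (diagGLUnits z) M = M at hz
    conv_lhs => rw [← hz]
    rw [map_inv, mapGL_inv_mapGL]

/-- `S̃(M)` — the UNIT diagonal stabiliser `latticeStabilizer M ⊓ unitTorus`. [cite: Kottwitz1986BaseChangeUnits, §1 pp. 240–241] -/
def unitStabilizer (M : Submodule 𝒪[K] (Fin N → K)) : Subgroup (Fin N → Kˣ) := latticeStabilizer M ⊓ unitTorus K N

/-- `S_F(M)` — the `σ`-FIXED unit diagonal stabiliser `latticeStabilizer M ⊓ fixedUnitTorus σ`. [cite: Rogawski1990, §4.9 p. 55] -/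
def fixedUnitStabilizer (σ : K →+* K) (M : Submodule 𝒪[K] (Fin N → K)) : Subgroup (Fin N → Kˣ) := latticeStabilizer M ⊓ fixedUnitTorus σ N

/-- **THE WEIGHT `1∕[𝒰 : S_F(M)]`** of the (S-fin) count (LH4-p10 MEMO v1 §2 (3); `Subgroup.relIndex`, a natural number, `0` only if the index were infinite — excluded for lattices by ★ L
p855451 + `Fintype 𝓀[K]`), as a rational number. [cite: Kottwitz1986BaseChangeUnits, §1 pp. 240–241] -/
def stabiliserWeight (σ : K →+* K) (M : Submodule 𝒪[K] (Fin N → K)) : ℚ :=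
  (((fixedUnitStabilizer σ M).relIndex (fixedUnitTorus σ N) : ℕ) : ℚ)⁻¹

/-! ## §4  Normalised and dualisable lattices; the finite set `𝓛₀(T)` -/

/-- **NORMALISED**: every coordinate ideal of `M` is exactly `𝒪` (`∀ x ∈ M, |x_i| ≤ 1` and some `x ∈ M` has `|x_i| = 1`; ★ p855280 `normalised_latt_hnf_iff`, ★ p855425). [cite: Serre1980Trees, II §1.1] -/
def IsNormalisedLattice (M : Submodule 𝒪[K] (Fin N → K)) : Prop :=
  ∀ i, (∀ x ∈ M, Valued.v (x i) ≤ 1) ∧ ∃ x ∈ M, Valued.v (x i) = 1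

/-- **DUALISABLE**: `M` is SELF-DUAL (a type-`0` vertex) for SOME non-degenerate `σ`-fixed diagonal form `diag D` — i.e. `M^{♯_1} ∈ (F^×)^N · M` (LH4-p10 MEMO v1 §1; ★ p855307 makes the
`D` a coset of `S_F(M)`, ★ p855415 makes the property invariant under `diag z`). [cite: Rogawski1990, §4.9 Prop. 4.9.1 (a) p. 55] -/
def IsDualisableLattice (σ : K →+* K) (ϖ : K) (M : Submodule 𝒪[K] (Fin N → K)) : Prop :=
  ∃ D : Fin N → K, (∀ i, σ (D i) = D i ∧ D i ≠ 0) ∧ IsVertexLattice σ ϖ (Matrix.diagonal D) 0 M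

/-- **`𝓛₀(T)`** — the NORMALISED `T`-STABLE LATTICES: `M = latt g` with `T·M = M` and every coordinate ideal `= 𝒪` (finite for a regular unit diagonal `T`: ★ p12's brick; of cardinality
`q^{Σ n}` for `T = diag(α, β, 1)` — ★ p855280∕p855304's HNF model). [cite: Kottwitz1986BaseChangeUnits, §1 pp. 240–241] -/
def normalisedStableLattices (T : GL (Fin N) K) : Set (Submodule 𝒪[K] (Fin N → K)) :=
  {M | (∃ g : GL (Fin N) K, M = latt (g : Matrix (Fin N) (Fin N) K)) ∧ mapGL T M = M ∧ IsNormalisedLattice M}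

/-! ## §5  `Iff.rfl` ties -/

/-- Membership in the unit torus. [cite: Kottwitz1986BaseChangeUnits, §1 pp. 240–241] -/
theorem mem_unitTorus_iff (z : Fin N → Kˣ) : z ∈ unitTorus K N ↔ ∀ i, Valued.v (z i : K) = 1 := Iff.rfl

omit [Valued K ℤᵐ⁰] in
/-- Membership in the `σ`-fixed vectors. [cite: Rogawski1990, §4.9 p. 55] -/
theorem mem_fixedTorus_iff (σ : K →+* K) (z : Fin N → Kˣ) : z ∈ fixedTorus σ N ↔ ∀ i, σ (z i : K) = z i := Iff.rfl

/-- Membership in `𝒰`. [cite: Rogawski1990, §4.9 p. 55] -/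
theorem mem_fixedUnitTorus_iff (σ : K →+* K) (z : Fin N → Kˣ) :
    z ∈ fixedUnitTorus σ N ↔ (∀ i, Valued.v (z i : K) = 1) ∧ ∀ i, σ (z i : K) = z i := Iff.rfl

omit [Valued K ℤᵐ⁰] in
/-- The norm map, coordinatewise. [cite: Rogawski1990, §4.9 p. 55] -/
theorem unitNormMap_apply (σ : K →+* K) (z : Fin N → Kˣ) (i : Fin N) : ((unitNormMap σ N z i : Kˣ) : K) = z i * σ (z i) := rfl

omit [Valued K ℤᵐ⁰] in
/-- Membership in the norm-one torus. [cite: Rogawski1990, §4.9 p. 55] -/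
theorem mem_normOneTorus_iff (σ : K →+* K) (z : Fin N → Kˣ) : z ∈ normOneTorus σ N ↔ unitNormMap σ N z = 1 := Iff.rfl

/-- Membership in the diagonal stabiliser. [cite: Kottwitz1986BaseChangeUnits, §1 pp. 240–241] -/
theorem mem_latticeStabilizer_iff (M : Submodule 𝒪[K] (Fin N → K)) (z : Fin N → Kˣ) : z ∈ latticeStabilizer M ↔ mapGL (diagGLUnits z) M = M := Iff.rfl

/-- Membership in `S̃(M)`. [cite: Kottwitz1986BaseChangeUnits, §1 pp. 240–241] -/
theorem mem_unitStabilizer_iff (M : Submodule 𝒪[K] (Fin N → K)) (z : Fin N → Kˣ) :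
    z ∈ unitStabilizer M ↔ mapGL (diagGLUnits z) M = M ∧ ∀ i, Valued.v (z i : K) = 1 := Iff.rfl

/-- Membership in `S_F(M)`. [cite: Rogawski1990, §4.9 p. 55] -/
theorem mem_fixedUnitStabilizer_iff (σ : K →+* K) (M : Submodule 𝒪[K] (Fin N → K)) (z : Fin N → Kˣ) :
    z ∈ fixedUnitStabilizer σ M ↔ mapGL (diagGLUnits z) M = M ∧ (∀ i, Valued.v (z i : K) = 1) ∧ ∀ i, σ (z i : K) = z i := Iff.rfl

/-- Membership in `𝓛₀(T)`. [cite: Kottwitz1986BaseChangeUnits, §1 pp. 240–241] -/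
theorem mem_normalisedStableLattices_iff (T : GL (Fin N) K) (M : Submodule 𝒪[K] (Fin N → K)) :
    M ∈ normalisedStableLattices T ↔ (∃ g : GL (Fin N) K, M = latt (g : Matrix (Fin N) (Fin N) K)) ∧ mapGL T M = M ∧ IsNormalisedLattice M := Iff.rfl

end Summit.HodgeConjecture.HodgeConjecture.Cruxes.H413.F0P3cDyRamDiagonalTorusDefs

end
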